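import Mathlib.RingTheory.Valuation.ValuationSubring
import Mathlib.LinearAlgebra.Dimension.Finrank
import Mathlib.LinearAlgebra.FiniteDimensional.Lemmas
import Mathlib.LinearAlgebra.Dimension.StrongRankCondition
import Mathlib.LinearAlgebra.Matrix.ToLinearEquiv
import Mathlib.Algebra.BigOperators.Ring.Finset
import HarnessLib

/-!
# Monomials with independent values: `♯E ≥ r` and the exponent matrix is nonsingular

Topic: `Literature/AlgebraicGeometry/Resolution`. PROOF side of `CossartPiltant2019ReductionP`
(`ArithmeticalThreefoldsLocal.lean`), input (C4), [CoP1] Prop. 8.1 / Prop. 9.3 (V. Cossart,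
O. Piltant, HAL hal-00139124, pp. 22 and 27). Two elementary steps of the printed proofs:

> (33) `♯(E) ≥ r`, since the values `{W f_j}_{1 ≤ j ≤ r}` are linearly independent (hence the
> values `{W yᵢ}_{i ∈ E}` generate `W L ⊗_ℤ ℚ`). (p. 22)
>
> For each `i`, `1 ≤ i ≤ r`, there is an expression `fᵢ = γᵢ ∏ⱼ xⱼ^{a_{ij}}`, where `γᵢ` is
> a unit in `S′`. Since `(V fᵢ)` and `(V′ xⱼ)` are bases of `V′K′ ⊗_ℤ ℚ`, the matrix
> `A := (a_{ij})` is nonsingular. (p. 27)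

Here the `fᵢ` are `r` elements whose VALUES are multiplicatively independent
(`∏ v(fᵢ)^{pᵢ} = ∏ v(fᵢ)^{mᵢ} ⇒ p = m`) and which are monomials (times units) in parameters
`x_c`, `c ∈ E`. We PROVE: every integer row relation of the exponent vectors vanishes
(`eq_zero_of_forall_sum_mul_eq_zero`), hence `r ≤ ♯E` (`le_card_of_independent`) and, when
the exponents are arranged in a square matrix, its determinant is nonzero
(`det_ne_zero_of_independent`). Values are taken in an arbitrary commutative monoid.

Everything is PROVED; no named facts, definitions, instances or notation are introduced.

## Sources

* V. Cossart, O. Piltant, J. Algebra 320 (2008) 1051–1082: proof of Prop. 8.1, (33), and proof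
  of Prop. 9.3 (HAL hal-00139124, pp. 22, 27). [CossartPiltant2008]
-/

namespace Literature.AlgebraicGeometry.Resolution

open Function

section Independent

variable {Γ : Type*} [CommMonoid Γ] {r d : ℕ}
  (vf : Fin r → Γ) (vx : Fin d → Γ) (a : Fin r → Fin d → ℕ)
  (hf : ∀ i, vf i = ∏ c, vx c ^ a i c)
  (hind : ∀ p m : Fin r → ℕ, ∏ i, vf i ^ p i = ∏ i, vf i ^ m i → p = m)

include hf hind in
/-- **Integer row relations of the exponent matrix vanish** when the values of the monomials
`fᵢ` (`v(fᵢ) = ∏ v(x_c)^{a_{ic}}`) are multiplicatively independent: if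
`∑ᵢ κᵢ a_{ic} = 0` for every `c` then `κ = 0` (split `κ = κ⁺ − κ⁻` and compare
`∏ v(fᵢ)^{κᵢ⁺}` with `∏ v(fᵢ)^{κᵢ⁻}`). [cite: CossartPiltant2008, proof of Prop. 9.3 (HAL p. 27)] -/
theorem eq_zero_of_forall_sum_mul_eq_zero (κ : Fin r → ℤ)
    (hκ : ∀ c, ∑ i, κ i * (a i c : ℤ) = 0) : κ = 0 := by
  classical
  set p : Fin r → ℕ := fun i => (κ i).toNat with hp
  set m : Fin r → ℕ := fun i => (-κ i).toNat with hm
  have hpm : ∀ c, ∑ i, p i * a i c = ∑ i, m i * a i c := by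
    intro c
    have h1 : ∀ i, (κ i : ℤ) = (p i : ℤ) - (m i : ℤ) := fun i =>
      (Int.toNat_sub_toNat_neg (κ i)).symm
    have h2 : (∑ i, (p i : ℤ) * (a i c : ℤ)) - ∑ i, (m i : ℤ) * (a i c : ℤ) = 0 := by
      rw [← Finset.sum_sub_distrib, ← hκ c]
      refine Finset.sum_congr rfl fun i _ => ?_
      rw [h1 i]; ring
    exact_mod_cast (sub_eq_zero.mp h2)
  have hprod : ∀ q : Fin r → ℕ, ∏ i, vf i ^ q i = ∏ c, vx c ^ ∑ i, q i * a i c := by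
    intro q
    calc ∏ i, vf i ^ q i = ∏ i, ∏ c, vx c ^ (q i * a i c) := by
          refine Finset.prod_congr rfl fun i _ => ?_
          rw [hf i, ← Finset.prod_pow]
          refine Finset.prod_congr rfl fun c _ => ?_
          rw [← pow_mul, mul_comm]
      _ = ∏ c, ∏ i, vx c ^ (q i * a i c) := Finset.prod_comm
      _ = ∏ c, vx c ^ ∑ i, q i * a i c := by
          refine Finset.prod_congr rfl fun c _ => ?_
          rw [Finset.prod_pow_eq_pow_sum]
  have heq : p = m := by
    apply hind
    rw [hprod p, hprod m]
    exact Finset.prod_congr rfl fun c _ => by rw [hpm c]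
  funext i
  have h1 : (κ i : ℤ) = (p i : ℤ) - (m i : ℤ) := (Int.toNat_sub_toNat_neg (κ i)).symm
  rw [Pi.zero_apply, h1, heq, sub_self]

include hf hind in
/-- **(33): `♯E ≥ r`.** If the exponent vectors of the `r` monomials `fᵢ` with independent
values are supported in a set `E` of indices, then `r ≤ ♯E` (they are `ℤ`-linearly
independent vectors of `ℤ^E`). [cite: CossartPiltant2008, proof of Prop. 8.1, (33) (HAL p. 22)] -/
theorem le_card_of_independent (E' : Finset (Fin d)) (hsupp : ∀ i c, c ∉ E' → a i c = 0) :
    r ≤ E'.card := by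
  classical
  have hli : LinearIndependent ℤ (fun i : Fin r => fun c : E' => (a i c : ℤ)) := by
    rw [Fintype.linearIndependent_iff]
    intro g hg
    have hκ : ∀ c, ∑ i, g i * (a i c : ℤ) = 0 := by
      intro c
      by_cases hc : c ∈ E'
      · have := congr_fun hg ⟨c, hc⟩
        simpa only [Finset.sum_apply, Pi.smul_apply, smul_eq_mul, Pi.zero_apply] using this
      · simp only [hsupp _ c hc, Nat.cast_zero, mul_zero, Finset.sum_const_zero]
    have := eq_zero_of_forall_sum_mul_eq_zero vf vx a hf hind g hκ
    exact fun i => congr_fun this i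
  have h := hli.fintype_card_le_finrank
  rw [Module.finrank_fintype_fun_eq_card, Fintype.card_fin, Fintype.card_coe] at h
  exact h

include hf hind in
/-- **The exponent matrix is nonsingular** ([CoP1] proof of Prop. 9.3: "the matrix
`A := (a_{ij})` is nonsingular"): if the exponent vectors of the `r` monomials `fᵢ` with
independent values are supported in the range of `e : Fin r → Fin d`, then the square matrix
`(a_{i, e j})` has nonzero determinant (over `ℤ`).
[cite: CossartPiltant2008, proof of Prop. 9.3 (HAL p. 27)] -/
theorem det_ne_zero_of_independent (e : Fin r → Fin d)
    (hsupp : ∀ i c, c ∉ Set.range e → a i c = 0) :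
    (Matrix.of fun i j => ((a i (e j) : ℕ) : ℤ)).det ≠ 0 := by
  classical
  intro hdet
  -- over `ℚ`
  set A : Matrix (Fin r) (Fin r) ℚ := Matrix.of fun i j => ((a i (e j) : ℕ) : ℚ) with hA
  have hAdet : A.det = 0 := by
    have h := RingHom.map_det (Int.castRingHom ℚ) (Matrix.of fun i j => ((a i (e j) : ℕ) : ℤ))
    rw [hdet, map_zero] at h
    rw [hA]
    convert h.symm using 2
    ext i j
    simp [Matrix.map_apply]
  obtain ⟨v, hv0, hv⟩ := Matrix.exists_vecMul_eq_zero_iff.mpr hAdet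
  -- clear denominators
  set D : ℕ := ∏ i, (v i).den with hD
  have hDpos : 0 < D := Finset.prod_pos fun i _ => (v i).den_pos
  have hdvd : ∀ i, (v i).den ∣ D := fun i => Finset.dvd_prod_of_mem _ (Finset.mem_univ i)
  let w : Fin r → ℤ := fun i => (v i).num * ((D / (v i).den : ℕ) : ℤ)
  have hw : ∀ i, (w i : ℚ) = v i * D := by
    intro i
    have hden : ((v i).den : ℚ) ≠ 0 := Nat.cast_ne_zero.mpr (v i).den_pos.ne'
    simp only [w, Int.cast_mul, Int.cast_natCast]
    rw [Nat.cast_div (hdvd i) hden, ← Rat.mul_den_eq_num (v i)]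
    field_simp
  have hκ : ∀ c, ∑ i, w i * (a i c : ℤ) = 0 := by
    intro c
    by_cases hc : c ∈ Set.range e
    · obtain ⟨j, rfl⟩ := hc
      have hj := congr_fun hv j
      simp only [Matrix.vecMul, dotProduct, hA, Matrix.of_apply, Pi.zero_apply] at hj
      have : ((∑ i, w i * (a i (e j) : ℤ) : ℤ) : ℚ) = (D : ℚ) * ∑ i, v i * (a i (e j) : ℚ) := by
        push_cast
        rw [Finset.mul_sum]
        refine Finset.sum_congr rfl fun i _ => ?_
        rw [hw i]; ring
      rw [hj, mul_zero] at this
      exact_mod_cast this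
    · simp only [hsupp _ c hc, Nat.cast_zero, mul_zero, Finset.sum_const_zero]
  have hw0 := eq_zero_of_forall_sum_mul_eq_zero vf vx a hf hind w hκ
  apply hv0
  funext i
  have h1 : (w i : ℚ) = 0 := by rw [congr_fun hw0 i]; simp
  rw [hw i] at h1
  have hD0 : (D : ℚ) ≠ 0 := Nat.cast_ne_zero.mpr hDpos.ne'
  simpa [hD0] using h1

end Independent

end Literature.AlgebraicGeometry.Resolution
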